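import Summits.CriticalPhenomena.PercolationContinuityZ3.Theorems.PercNearOneGluingNoHeavyLowerTailSahiCombMixFourSingleOne

/-!
# The comb (tensor-Bernstein) hierarchy for Sahi's `E_k`, XL: comb H-MIX(4) — the singleton four-slot cell with TWO mixed events (`|G| = 2`)

Support file of the one-cut programme (crux `NoHeavyLowerTail`, stmt-CriticalPhenomena-4575; cell `prim-masterthm`, seat P3, gen 8; HIERARCHY.md §15(d),(i)).
The second class of `SahiCombMix.CombFourSingletonCells`: the coordinate `e` OR-ed into `U_0, U_1` out of four events ignoring `e` with `CombHereditary U`.  The cube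
version of gen 5's hereditary `(4,2)` identity (`SahiMixture.sahiE_four_orCoin_two_eq`): with `X = E_3(U_0∩U_1, U_2, U_3) + (1 + ½μ(Ū_0Ū_1))Cov(U_2,U_3) + μ(Ū_0Ū_1U_2U_3)`
and `C = Cov(U_2, U_3)`, the degree-4 Bernstein coefficients along `p_e` are `E_4(U)`, `2E_4 + 2X`, `E_4 + 4X + 2C`, `2X + 4C`, `2C` — comb-positive off `e` from the
hereditary comb rows `E_4(U)`, `E_3(U_{01}, U_2, U_3)`, `Cov(U_2, U_3)` and the two defect moments (inhomogeneous LP kit j113450 agrees: three rows per coefficient).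
* `combPos_codefect01`, `combPos_defect0123` — the defect moments `μ_p(Ū_0Ū_1)`, `μ_p(Ū_0Ū_1U_2U_3)` in moment form, comb-positive at multidegree `1` off `e`.
* **`combPos_fourSlot_G2`** — the cell for `G = (true, true, false, false)`. [this work]
-/

noncomputable section

open scoped Classical

namespace Summit.CriticalPhenomena.PercolationContinuityZ3.Theorems

open Finset Function
open Literature.Combinatorics.Sahi2008
open Literature.Probability.Percolation.BHK2006 (ind_le_one ind_inter)
open Literature.Probability.Percolation.DecisionTree (ind ind_of_mem ind_of_not_mem ind_nonneg)
open SahiComb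
open SahiCombDisjunct (orCoord)
open SahiCombHereditary (CombHereditary)

variable {ι : Type} [Fintype ι]

namespace SahiCombMix

section Defects

variable (U : Fin 4 → Set (Set ι)) (e : ι) (hUe : ∀ (j : Fin 4) (b : Bool), secAt e b (U j) = U j)
include hUe

/-- `μ_p(Ū_0 ∩ Ū_1) = 1 − μ_p(U_0) − μ_p(U_1) + μ_p(U_0∩U_1)` is comb-positive at multidegree `1` off `e`. [this work] -/
theorem combPos_codefect01 :
    CombPos (update (fun _ : ι => 1) e 0) (fun p => 1 - ex (bernoulliWeight p) (ind (U 0)) - ex (bernoulliWeight p) (ind (U 1))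
      + ex (bernoulliWeight p) (ind (U 0) * ind (U 1))) := by
  have h0 := (combPos_ex (ι := ι) (h := fun ω => (1 - ind (U 0) ω) * (1 - ind (U 1) ω)) fun ω =>
      mul_nonneg (sub_nonneg.2 (ind_le_one (U 0) ω)) (sub_nonneg.2 (ind_le_one (U 1) ω))).of_ignores e
    fun p s => SahiCombDisjunct.ex_update_of_ignores' e (fun ω => by
      show (1 - ind (U 0) (insert e ω)) * (1 - ind (U 1) (insert e ω)) = (1 - ind (U 0) ω) * (1 - ind (U 1) ω)
      rw [ind_U4_insert U e hUe, ind_U4_insert U e hUe]) p s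
  refine h0.congr fun p => ?_
  have ee := SahiMixture.ex_eq_lin (bernoulliWeight p) (fun ω => (1 - ind (U 0) ω) * (1 - ind (U 1) ω)) ![1, -1, -1, 1]
    ![fun _ => 1, ind (U 0), ind (U 1), ind (U 0) * ind (U 1)] (fun ω => by simp [Fin.sum_univ_succ]; ring)
  simp only [Fin.sum_univ_succ, Fin.sum_univ_zero, Matrix.cons_val_zero, Matrix.cons_val_succ, ex_const (sum_bernoulliWeight p)] at ee
  rw [ee]; ring

/-- `μ_p(Ū_0 ∩ Ū_1 ∩ U_2 ∩ U_3) = μ_p(U_{23}) − μ_p(U_{023}) − μ_p(U_{123}) + μ_p(U_{0123})` is comb-positive at multidegree `1` off `e`. [this work] -/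
theorem combPos_defect0123 :
    CombPos (update (fun _ : ι => 1) e 0) (fun p => ex (bernoulliWeight p) (ind (U 2) * ind (U 3))
      - ex (bernoulliWeight p) (ind (U 0) * ind (U 2) * ind (U 3)) - ex (bernoulliWeight p) (ind (U 1) * ind (U 2) * ind (U 3))
      + ex (bernoulliWeight p) (ind (U 0) * ind (U 1) * ind (U 2) * ind (U 3))) := by
  have h0 := (combPos_ex (ι := ι) (h := fun ω => (1 - ind (U 0) ω) * (1 - ind (U 1) ω) * ind (U 2) ω * ind (U 3) ω) fun ω =>
      mul_nonneg (mul_nonneg (mul_nonneg (sub_nonneg.2 (ind_le_one (U 0) ω)) (sub_nonneg.2 (ind_le_one (U 1) ω))) (ind_nonneg (U 2) ω))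
        (ind_nonneg (U 3) ω)).of_ignores e
    fun p s => SahiCombDisjunct.ex_update_of_ignores' e (fun ω => by
      show (1 - ind (U 0) (insert e ω)) * (1 - ind (U 1) (insert e ω)) * ind (U 2) (insert e ω) * ind (U 3) (insert e ω)
          = (1 - ind (U 0) ω) * (1 - ind (U 1) ω) * ind (U 2) ω * ind (U 3) ω
      rw [ind_U4_insert U e hUe, ind_U4_insert U e hUe, ind_U4_insert U e hUe, ind_U4_insert U e hUe]) p s
  refine h0.congr fun p => ?_
  have ee := SahiMixture.ex_eq_lin (bernoulliWeight p) (fun ω => (1 - ind (U 0) ω) * (1 - ind (U 1) ω) * ind (U 2) ω * ind (U 3) ω) ![1, -1, -1, 1]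
    ![ind (U 2) * ind (U 3), ind (U 0) * ind (U 2) * ind (U 3), ind (U 1) * ind (U 2) * ind (U 3), ind (U 0) * ind (U 1) * ind (U 2) * ind (U 3)]
    (fun ω => by simp [Fin.sum_univ_succ]; ring)
  simp only [Fin.sum_univ_succ, Fin.sum_univ_zero, Matrix.cons_val_zero, Matrix.cons_val_succ] at ee
  rw [ee]; ring

end Defects

/-- **The singleton four-slot cell with two mixed events** (`G = (1,1,0,0)`) is comb-positive at multidegree `4`. [this work] -/
theorem combPos_fourSlot_G2 (U : Fin 4 → Set (Set ι)) (e : ι) (hUe : ∀ (j : Fin 4) (b : Bool), secAt e b (U j) = U j) (hU : CombHereditary U) :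
    CombPos (fun _ : ι => 4) (fun p => sahiE (bernoulliWeight p) 4 (fun j => ind (orCoord U e (![true, true, false, false] : Fin 4 → Bool) j))) := by
  set Q : Fin 4 → Set (Set ι) := ![Set.univ, Set.univ, U 2, U 3] with hQdef
  have eS : (fun j => ind (orCoord U e (![true, true, false, false] : Fin 4 → Bool) j)) = fun j => ind (mixCoord e (U j) (Q j)) := by
    funext j; fin_cases j
    · exact congrArg ind (orCoord_eq_mixCoord_true U e _ 0 rfl)
    · exact congrArg ind (orCoord_eq_mixCoord_true U e _ 1 rfl)
    · exact congrArg ind (orCoord_eq_mixCoord_false U e _ 2 rfl)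
    · exact congrArg ind (orCoord_eq_mixCoord_false U e _ 3 rfl)
  have hQ : ∀ (j : Fin 4) (b : Bool), secAt e b (Q j) = Q j := by
    intro j b; fin_cases j
    · exact secAt_univ' e b
    · exact secAt_univ' e b
    · exact hUe 2 b
    · exact hUe 3 b
  have hPQ : ∀ j : Fin 4, U j ⊆ Q j := by
    intro j; fin_cases j
    · exact Set.subset_univ _
    · exact Set.subset_univ _
    · exact subset_rfl
    · exact subset_rfl
  have hI : ind (U 0 ∩ U 1) = ind (U 0) * ind (U 1) := funext fun ω => ind_inter _ _ ω
  -- the three hereditary comb rows, in moment form, all at multidegree `4` off `e`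
  have eU : (fun j => ind (⋂ i ∈ (![({0} : Finset (Fin 4)), {1}, {2}, {3}] : Fin 4 → Finset (Fin 4)) j, U i))
      = ![ind (U 0), ind (U 1), ind (U 2), ind (U 3)] := by
    funext j; fin_cases j <;> simp
  have eV : (fun j => ind (⋂ i ∈ (![({0, 1} : Finset (Fin 4)), {2}, {3}] : Fin 3 → Finset (Fin 4)) j, U i))
      = ![ind (U 0) * ind (U 1), ind (U 2), ind (U 3)] := by
    funext j; fin_cases j <;> simp [hI]
  have eW : (fun j => ind (⋂ i ∈ (![({2} : Finset (Fin 4)), {3}] : Fin 2 → Finset (Fin 4)) j, U i)) = ![ind (U 2), ind (U 3)] := by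
    funext j; fin_cases j <;> simp
  have r4 := hU.row_off e hUe 4 ![({0} : Finset (Fin 4)), {1}, {2}, {3}]
  rw [eU] at r4
  have r4m := r4
  simp only [sahiE_four] at r4m
  have r3 := (hU.row_off e hUe 3 ![({0, 1} : Finset (Fin 4)), {2}, {3}]).mono (deg_off_mono e (show 3 ≤ 4 by norm_num))
  rw [eV] at r3
  simp only [sahiE_three] at r3
  have r2 := hU.row_off e hUe 2 ![({2} : Finset (Fin 4)), {3}]
  rw [eW] at r2
  simp only [sahiE_two_apply, Matrix.cons_val_zero, Matrix.cons_val_one] at r2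
  have rC := r2.mono (deg_off_mono e (show 2 ≤ 4 by norm_num))
  have rNC := (combPos_mono12 e (combPos_codefect01 U e hUe) r2).mono (deg_off_mono e (show 3 ≤ 4 by norm_num))
  have rD := (combPos_defect0123 U e hUe).mono (deg_off_mono e (show 1 ≤ 4 by norm_num))
  have eP : (fun j => ind (U j)) = ![ind (U 0), ind (U 1), ind (U 2), ind (U 3)] := by funext j; fin_cases j <;> rfl
  have eQ : (fun j => ind (Q j)) = ![1, 1, ind (U 2), ind (U 3)] := by
    funext j; fin_cases j <;> simp [hQdef, ind_univ_eq_one]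
  have q0 : ind (Q 0) = 1 := by simp [hQdef, ind_univ_eq_one]
  have q1 : ind (Q 1) = 1 := by simp [hQdef, ind_univ_eq_one]
  have q2 : Q 2 = U 2 := rfl
  have q3 : Q 3 = U 3 := rfl
  rw [eS]
  refine combPos_four_mixCoord_of_coeffs e U Q hUe hQ hPQ ?_ ?_ ?_ ?_ ?_
  · rw [eP]; exact r4
  · -- c₁ = 2E₄ + 2E₃' + 2C + N₀₁·C + 2D
    refine (((((r4m.smul (by norm_num : (0:ℝ) ≤ 2)).add (r3.smul (by norm_num : (0:ℝ) ≤ 2))).add (rC.smul (by norm_num : (0:ℝ) ≤ 2))).add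
      rNC).add (rD.smul (by norm_num : (0:ℝ) ≤ 2))).congr fun p => ?_
    simp only [mix4C1, q0, q1, q2, q3, one_mul, mul_one, ex_one (sum_bernoulliWeight p)]
    ring
  · -- c₂ = E₄ + 4E₃' + 6C + 2N₀₁·C + 4D
    refine (((((r4m.smul (by norm_num : (0:ℝ) ≤ 1)).add (r3.smul (by norm_num : (0:ℝ) ≤ 4))).add (rC.smul (by norm_num : (0:ℝ) ≤ 6))).add
      (rNC.smul (by norm_num : (0:ℝ) ≤ 2))).add (rD.smul (by norm_num : (0:ℝ) ≤ 4))).congr fun p => ?_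
    simp only [mix4C2, q0, q1, q2, q3, one_mul, mul_one, ex_one (sum_bernoulliWeight p)]
    ring
  · -- c₃ = 2E₃' + 6C + N₀₁·C + 2D
    refine ((((r3.smul (by norm_num : (0:ℝ) ≤ 2)).add (rC.smul (by norm_num : (0:ℝ) ≤ 6))).add rNC).add
      (rD.smul (by norm_num : (0:ℝ) ≤ 2))).congr fun p => ?_
    simp only [mix4C3, q0, q1, q2, q3, one_mul, mul_one, ex_one (sum_bernoulliWeight p)]
    ring
  · -- c₄ = E₄(Ω, Ω, U₂, U₃) = 2C
    refine (rC.smul (by norm_num : (0:ℝ) ≤ 2)).congr fun p => ?_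
    rw [eQ, sahiE_four]
    simp only [one_mul, ex_one (sum_bernoulliWeight p)]
    ring

end SahiCombMix

end Summit.CriticalPhenomena.PercolationContinuityZ3.Theorems

end
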